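/-
Copyright (c) 2026 the pub-hodgecm-mathlib formalisation cell (harness21).  Prover seat hodgecm-mathlib-LH4-p11 (g12), req620 Track A «(D-RAM) FOUR-FRAME» squad
((β₂) road (R-36), the K6 road — K6 DESK WORD #29 (2b) «GAP-ZERO-OF-ROW»: the W = 0 branch of A6 `core_holds` ∕ `coreOdd_holds` as ONE named wrapper per parity, from ★ (δ) p865093
`exists_rowDiagChart_letters_gapZero`, ★ `exists_repr_fixedBall_card`, ★ (γ-2) `diagCell_law_hyper_gapZero` ∕ `diagCell_law_aniso_gapZero` (LH4-p15 (g3)), ★ A5-SIZES p865144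
`exists_topCell_density_of_row(_odd) (N := 0)` (LH4-p08 (g12)) and ★ (γ) p865076 `diagCell_gapZero_identity_of_laws` (LH4-p15 (g3))), 2026-09-05.
-/
import Summits.HodgeConjecture.HodgeConjecture.Theorems.F0P3cDyRamDiagCellGapZeroIdentity       -- ★ (γ) p865076 (LH4-p15 (g3)): `diagCell_gapZero_identity_of_laws` (the gap-zero top cell identity from its LAW and DENSITY letters)
import Summits.HodgeConjecture.HodgeConjecture.Theorems.F0P3cDyRamDiagCellGapZeroLawFrames      -- ★ (γ-2) (LH4-p15 (g3)): `diagCell_law_hyper_gapZero`, `diagCell_law_aniso_gapZero` (the two gap-zero cell LAWS at ‹CORE›'s frames, over ★ (α) F3 LH4-p12 (g10))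
import Summits.HodgeConjecture.HodgeConjecture.Theorems.F0P3cDyRamRowDiagChartLettersGapZero   -- ★ (δ) p865093 (LH4-p16 (g3)): `exists_rowDiagChart_letters_gapZero` (the row's gap-zero chart and label letters)
import Summits.HodgeConjecture.HodgeConjecture.Theorems.F0P3cDyRamTopCellDensityOfRow          -- ★ A5-SIZES p865144 (LH4-p08 (g12)): `exists_topCell_density_of_row`, `exists_topCell_density_of_row_odd` (`N = 0` allowed)
import Summits.HodgeConjecture.HodgeConjecture.Theorems.F0P3cDyRamDiagonalFixedClassSystems    -- ★ (LH4 lineage): `exists_repr_fixedBall_card` (a complete irredundant system of σ-fixed digits modulo `|ϖ|^n`)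
import HarnessLib

/-!
# Crux `H413`, line LH4 «(D-RAM) FOUR-FRAME» — (β₂) road, the K6 road, A6 wrapper (2b) «GAP-ZERO-OF-ROW»: «THE GAP-ZERO TOP CELL IDENTITY OF THE ROW» — the `W = 0` branch
# (`jl = m`: the window's top cell IS the diagonal cell `(b, b)`) of A6 `core_holds` ∕ `coreOdd_holds`, as ONE named theorem per parity, in ‹CORE.v1›'s frame letters ONLY

Cell `hodgecm-mathlib` (D-0151), FLOOR 0, crux item H413 = `stmt-HodgeConjecture-24833`, route of record `HCCMUnconditional`; squad F0∕P3c∕LH4; lane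
`--supports stmt-HodgeConjecture-24833 --as helper` (count-neutral; pays NO tier-0 row).  THEOREMS ONLY (no `def`, no instance, no notation, no `sorry`, default heartbeats);
★-only imports; states NO law; ‹CORE›∕‹CORE-ODD›∕‹D0›∕(β₂) stay HYPOTHESES of their consumers.

WHAT (K6 desk LH4-p16 (g3) WORD #29 (2): «`core_holds` is ONE command near the default heartbeat ceiling — its two `htop` branches become NAMED WRAPPERS, own command, own budget»;
(2a) TOP-OF-ROW → LH4-p18 (g5), (2b) GAP-ZERO-OF-ROW → this seat).  At window `W := (jl − m)∕2 = 0` ★ (P1) `coreWindow_of_insideWindow_and_topCell`'s `htop` reads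
`X_H(b) = if 0 < d then X_A(b) else 0` (the PARKED ‹D0› «X_H(b,b) = X_A(b,b)», LH4-p06 (g9) MECH-D0.v1 §4, at every `d ≥ 2` and both parities).  ★ (γ) p865076
`diagCell_gapZero_identity_of_laws` proves exactly those bytes from LETTERS: the gap-zero chart ((δ)), a digit system `Rd` mod `|ϖ|^n` (`2d − 1 ≤ n`), the two gap-zero CELL LAWS
(`hlawH`, `hlawA`) and the DENSITY (`hdensH`, `hdensA`).  THIS FILE discharges every letter from ‹CORE.v1›'s own frame binders, once per parity:
* the chart∕label letters `κ₀ ξ₀ μa μb R₀ γ₀ α₁ γ₁` with `|κ₀| = 1`, `|ξ₀| = 1`, `hαγ`∕`hγα`, `haff0` := ★ (δ) `exists_rowDiagChart_letters_gapZero … (hbm : 2b + d%2 = m) (hjlm : jl = m)`;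
* the digit system `Rt` modulo `|ϖ|^b` := ★ `exists_repr_fixedBall_card … b 0` (level `t := 0`, the card dropped; `2d − 1 ≤ b` from the K6 floor `4d ≤ N₀ ≤ m`);
* the two laws := ★ (γ-2) `diagCell_law_hyper_gapZero` ∕ `diagCell_law_aniso_gapZero` (LH4-p15 (g3); ★ A2-TOP p864968's heads at the gap-zero cell over ★ (α) F3
  `rowDiag_cellDiff_mul_card_eq_gapZero`, LH4-p12 (g10), precision letters discharged at `r := |ϖ|^b`);
* the density := ★ A5-SIZES `exists_topCell_density_of_row … (N := 0)` (`d` even: row `2b = m`) ∕ `exists_topCell_density_of_row_odd … (N := 0)` (`d` odd: row `2b + 1 = m`), LH4-p08 (g12), by `rcases Nat.mod_two_eq_zero_or_one d`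
  (`hξN : |ξ₀| = exp (2·0)` from `|ξ₀| = 1`; `b + 2·0 ↦ b` by `Nat.mul_zero`, `Nat.add_zero`; its `0 < d →` guard on `hdensA` discharged by `1 ≤ d` of the datum);
then `exact` ★ (γ).  ONE HEAD, BOTH PARITIES: `diagCell_gapZero_identity_of_row` with ★ A5's row letter `hbm : 2 * b + d % 2 = m` (the dealt pair `{…_of_row (2b = m), …_of_row_odd
(2b + 1 = m)}` collapses: the only parity-split input, ★ A5-SIZES, is selected inside by `d % 2`; A6 calls it with `hd0 : d % 2 = 0`, A6-ODD with `d % 2 = 1`, `by omega`).  BINDERS (all BY NAME from ‹CORE.v1› ∕ ★ A5 `topCell_identity` ∕ ★ A5-SIZES): the sheet `hD hσσ h2`, `jE ρ Θ α lam` with their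
letters, `u m jl hm hjl hum`, the HYPERBOLIC frame `γ₂ hΓ φ h hφs hφi hφo hφγ hform hΘh hh hhyper f hfinLS hf`, the ANISOTROPIC frame `P₁ dg η γA hA hΓ' hdg1 hdgσ hησ hη1 hηN φ' h'
hφ's hφ'i hφ'o hφ'γ hform' hΘh' hh' haniso f' hfinLS' hf'`, the K6 floor `{N₀} h4d hN₀m hu1N hlam1`, the row `b hbm` and the gap-zero window `hjlm : jl = m` (`1 ≤ b`, `2d − 1 ≤ b` inside, from `4d ≤ N₀ ≤ m`) — NO chart, NO digit
system, NO law, NO density letter.  CONCLUSION = ★ (γ)'s conclusion BYTES (= ★ (P1)'s `htop` at `N := 0`, `j := b`).  Consumer: A6's `W = 0` branch is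
`exact diagCell_gapZero_identity_of_row … b (by omega) hjlm` after `rw [hW0, Nat.mul_zero, Nat.add_zero]` (both A6 and A6-ODD).
WHAT IS NOT CLAIMED: any law, density, chart or size (all ★, imported BY NAME); the `W ≥ 1` windows ((2a) LH4-p18 (g5) over ★ A5); ‹CORE›∕‹CORE-ODD› themselves (A6, the desk).
HONEST LABEL.  Count-neutral composition of ★ pieces; nothing printed is asserted; no census law is stated; `HC_CM` is proved only modulo the 7 printed citations
(2 remaining named inputs: hLiu418 = `stmt-HodgeConjecture-24832`, h413 = `stmt-HodgeConjecture-24833`) until rung 0 closes.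
## References
* [Kottwitz1986BaseChangeUnits] R. E. Kottwitz, *Base change for unit elements of Hecke algebras*, Compositio Math. 60 (1986): §1 pp. 240–241 (signed lattice counts cell by cell).
* [LabesseLanglands1979] J.-P. Labesse, R. P. Langlands, *L-indistinguishability for SL(2)*, Canad. J. Math. 31 (1979): §2 (2.2) p. 9 (κ-signed counts).
* [Rogawski1990] J. D. Rogawski, *Automorphic Representations of Unitary Groups in Three Variables*, Ann. of Math. Stud. 123 (1990): §4.9 Prop. 4.9.1 (b) p. 55.
* [Serre1979] J.-P. Serre, *Local Fields*, GTM 67 (1979): Ch. V §3 Prop. 5, Cor. 2–3 pp. 84–86; Ch. XIV §2–§3 (digit systems of a local field).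
-/

set_option autoImplicit false

noncomputable section

namespace Summit.HodgeConjecture.HodgeConjecture.Cruxes.H413.F0P3cDyRamDiagCellGapZeroIdentityOfRow

open scoped Valued WithZero Matrix MatrixGroups Classical
open WithZero Finset
open Literature.NumberTheory.Automorphic Literature.NumberTheory.Automorphic.HermitianLattice Literature.NumberTheory.Automorphic.UnitaryLatticeTree
open Literature.NumberTheory.Automorphic.UnitaryThreeFourFrame (IsRamifiedQuadraticDatum normSign)
open Literature.NumberTheory.Rogawski1990
open Summit.HodgeConjecture.HodgeConjecture.Cruxes.H413.F0P3cDyRamFourFramePieces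
open Summit.HodgeConjecture.HodgeConjecture.Cruxes.H413.F0P3cDyRamFourFrameCensusDefs (LatticeInLevel LatticeNearTransvShell)
open Summit.HodgeConjecture.HodgeConjecture.Cruxes.H413.F0P3cDyRamStageOneBDefs (mcOfRecord)
open Summit.HodgeConjecture.HodgeConjecture.Cruxes.H413.F0P3cDyRamToricCensusDefs
open Summit.HodgeConjecture.HodgeConjecture.Cruxes.H413.F0P3cDyRamDiagCellGapZeroIdentity (diagCell_gapZero_identity_of_laws)
open Summit.HodgeConjecture.HodgeConjecture.Cruxes.H413.F0P3cDyRamDiagCellGapZeroLawFrames (diagCell_law_hyper_gapZero diagCell_law_aniso_gapZero)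
open Summit.HodgeConjecture.HodgeConjecture.Cruxes.H413.F0P3cDyRamRowDiagChartLettersGapZero (exists_rowDiagChart_letters_gapZero)
open Summit.HodgeConjecture.HodgeConjecture.Cruxes.H413.F0P3cDyRamTopCellDensityOfRow (exists_topCell_density_of_row exists_topCell_density_of_row_odd)
open Summit.HodgeConjecture.HodgeConjecture.Cruxes.H413.F0P3cDyRamDiagonalFixedClassSystems (exists_repr_fixedBall_card)

variable {E M : Type} [Field E] [Valued E ℤᵐ⁰] [Field M] [Valued M ℤᵐ⁰]

/-! ## §1 The gap-zero top cell identity of the row, both parities (A6 `core_holds` ∕ A6-ODD `coreOdd_holds`, their `W = 0` branch) -/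

/-- **HEAD — «THE GAP-ZERO TOP CELL IDENTITY OF THE ROW», BOTH PARITIES** (A6 wrapper (2b), K6 DESK WORD #29; the `W = 0` branch of `core_holds` AND of `coreOdd_holds`).
In ‹CORE.v1›'s frame letters BY NAME (the sheet `hD hσσ h2`; `jE ρ Θ α lam` with their letters; `u m jl hm hjl hum`; the hyperbolic frame `γ₂ hΓ φ h … hhyper f hfinLS hf`; the
anisotropic frame `P₁ dg η γA hA hΓ' … haniso f' hfinLS' hf'`; the K6 floor `h4d hN₀m hu1N hlam1`), for the live row `2b + d % 2 = m` (★ A5's row letter, both parities) at the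
gap-zero window `jl = m`: `X_H(b) = if 0 < d then X_A(b) else 0` — ★ (γ) `diagCell_gapZero_identity_of_laws`' conclusion bytes (= ★ (P1)'s `htop` at `N := 0`, `j := b`), every
letter of ★ (γ) discharged inside (★ (δ) chart, ★ digit system mod `|ϖ|^b`, ★ (γ-2) laws, ★ A5-SIZES density at `N := 0` — the even∕odd table picked by `d % 2`).
[cite: Kottwitz1986BaseChangeUnits, §1 pp. 240–241] [cite: LabesseLanglands1979, §2 (2.2) p. 9] [cite: Rogawski1990, §4.9 Prop. 4.9.1 (b) p. 55] [cite: Serre1979, Ch. XIV §2–§3] -/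
theorem diagCell_gapZero_identity_of_row [CompleteSpace E] [IsDiscreteValuationRing 𝒪[E]] [Finite 𝓀[E]] [CompleteSpace M] [IsDiscreteValuationRing 𝒪[M]] [Finite 𝓀[M]]
    (σ : E →+* E) (ϖ : E) (d tE : ℕ) (hD : IsRamifiedQuadraticDatum σ ϖ d tE) (hσσ : ∀ a, σ (σ a) = a)
    (jE : E →+* M) (ρ Θ : M →+* M) (α lam : M)
    (hρρ : ∀ z, ρ (ρ z) = z) (hvρ : ∀ z, Valued.v (ρ z) = Valued.v z)
    (hjv : ∀ a, Valued.v (jE a) ≤ 1 ↔ Valued.v a ≤ 1) (hjfix : ∀ z : M, ρ z = z ↔ ∃ a, jE a = z) (hΘj : ∀ a, Θ (jE a) = jE (σ a))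
    (hΘΘ : ∀ z, Θ (Θ z) = z) (hΘρ : ∀ z, Θ (ρ z) = ρ (Θ z)) (hvΘ : ∀ z, Valued.v (Θ z) = Valued.v z)
    (hα : ρ α ≠ α) (hα1 : Valued.v α ≤ 1) (hint : ∀ z : M, Valued.v z ≤ 1 → Valued.v ((z - ρ z) / (α - ρ α)) ≤ 1)
    (hΘlam : Θ lam * lam = 1) (hvlam : Valued.v lam = 1) (hU : Valued.v (α - ρ α) = 1) (hτ : Valued.v (α - Θ α) < 1)
    (hσres : ∀ z : M, ρ z = z → Valued.v z ≤ 1 → Valued.v (Θ z - z) < 1)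
    (hDM : IsRamifiedQuadraticDatum Θ (jE ϖ) d tE) (hjiso : ∀ a, Valued.v (jE a) = Valued.v a)
    (hq : Nat.card 𝓀[M] = Nat.card 𝓀[E] ^ 2) (hjpow : ∀ (t : E) (n : ℤ), Valued.v (jE t) = Valued.v (jE ϖ) ^ n ↔ Valued.v t = Valued.v ϖ ^ n)
    (hϖmax : ∀ t : M, ρ t = t → Valued.v t < 1 → Valued.v t ≤ Valued.v (jE ϖ))
    (u : GL (Fin 1) E) (m jl : ℕ) (hm : Valued.v (lam - jE ((u : Matrix (Fin 1) (Fin 1) E) 0 0)) = WithZero.exp (-(m : ℤ)))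
    (hjl : Valued.v ((lam - jE ((u : Matrix (Fin 1) (Fin 1) E) 0 0)) - ρ (lam - jE ((u : Matrix (Fin 1) (Fin 1) E) 0 0))) = WithZero.exp (-(jl : ℤ)))
    (hum : Valued.v (((u : Matrix (Fin 1) (Fin 1) E) 0 0) - 1) ≤ Valued.v (ϖ ^ mstarOfRecord d)) (h2 : ¬ IsUnit (2 : 𝒪[E]))
    -- the HYPERBOLIC frame `(γ₂, φ, h, f)` in the identity frame (‹CORE.v1›'s `_hΓ _hφs … _hf _hfinLS`)
    (γ₂ : GL (Fin 2) E) (hΓ : endoGL (γ₂, u) ∈ unitaryGroupOfForm σ ((StdForm.antidiagonal 3).over E))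
    (φ : (Fin 2 → E) →+ M) (h : M) (hφs : ∀ (c : E) (x : Fin 2 → E), φ (c • x) = jE c * φ x) (hφi : Function.Injective φ) (hφo : Function.Surjective φ)
    (hφγ : ∀ x, φ ((γ₂ : Matrix (Fin 2) (Fin 2) E).mulVec x) = lam * φ x)
    (hform : ∀ x y, jE (pairing σ ((StdForm.antidiagonal 2).over E) x y) = h * Θ (φ x) * φ y + ρ (h * Θ (φ x) * φ y)) (hΘh : Θ h = h) (hh : h ≠ 0)
    (hhyper : ∃ x : M, x ≠ 0 ∧ h * Θ x * x + ρ (h * Θ x * x) = 0)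
    (f : ℕ → ℕ → AddSubgroup M → ℕ) (hfinLS : ∀ j a, (levelSet ρ Θ α (jE ϖ) h j a).Finite)
    (hf : ∀ (b j : ℕ) (Λ : AddSubgroup M) (x₀ : M) (r : E), 1 ≤ b → x₀ ≠ 0 → (∀ x, x ∈ Λ ↔ ∃ z, IsOrd ρ α (jE ϖ ^ j) z ∧ x = x₀ * z) →
      IsOrd ρ α (jE ϖ ^ j) (dualGen ρ Θ α (jE ϖ ^ j) h x₀) → ¬ IsOrd ρ α (jE ϖ ^ j) (dualGen ρ Θ α (jE ϖ ^ j) h x₀ / jE ϖ) → Valued.v (dualGen ρ Θ α (jE ϖ ^ j) h x₀) = Valued.v (jE ϖ) ^ b →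
      (∀ b', (∀ x ∈ Λ, Valued.v (h * Θ x * b' + ρ (h * Θ x * b')) ≤ 1) → (lam - jE ((u : Matrix (Fin 1) (Fin 1) E) 0 0)) * b' ∈ Λ) → IsOrd ρ α (jE ϖ ^ j) lam →
      jE r = glueUnit ρ Θ α (jE ϖ ^ j) h (jE ϖ) (jE (1 : E)) x₀ b →
      f b j Λ = Nat.card {x : 𝒪[E] ⧸ 𝓂[E] ^ (2 * b) // ∃ u' : 𝒪[E], Ideal.Quotient.mk (𝓂[E] ^ (2 * b)) u' = x ∧ Valued.v ((u' : E) * σ u' - r) ≤ Valued.v (ϖ ^ (2 * b))})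
    -- the ANISOTROPIC frame `(P₁, dg, η, γA, φ′, h′, f′)` (‹CORE.v1›'s `P₁ dg η γ₁ _hA _hΓ' _hdg1 _hdgσ _hησ _hη1 _hηN …`; `γA` = its `γ₁`)
    (P₁ : GL (Fin 3) E) (dg : Fin 2 → E) (η : E) (γA : GL (Fin 2) E)
    (hA : formCongr σ P₁ ((StdForm.antidiagonal 3).over E) =
      (!![(Matrix.diagonal dg) 0 0, 0, (Matrix.diagonal dg) 0 1; 0, η, 0; (Matrix.diagonal dg) 1 0, 0, (Matrix.diagonal dg) 1 1] : Matrix (Fin 3) (Fin 3) E))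
    (hΓ' : P₁ * endoGL (γA, u) * P₁⁻¹ ∈ unitaryGroupOfForm σ ((StdForm.antidiagonal 3).over E))
    (hdg1 : ∀ i, Valued.v (dg i) = 1) (hdgσ : ∀ i, σ (dg i) = dg i) (hησ : σ η = η) (hη1 : Valued.v η = 1) (hηN : ¬ ∃ t : E, t * σ t = η)
    (φ' : (Fin 2 → E) →+ M) (h' : M) (hφ's : ∀ (c : E) (x : Fin 2 → E), φ' (c • x) = jE c * φ' x) (hφ'i : Function.Injective φ') (hφ'o : Function.Surjective φ')
    (hφ'γ : ∀ x, φ' ((γA : Matrix (Fin 2) (Fin 2) E).mulVec x) = lam * φ' x)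
    (hform' : ∀ x y, jE (pairing σ (Matrix.diagonal dg) x y) = h' * Θ (φ' x) * φ' y + ρ (h' * Θ (φ' x) * φ' y)) (hΘh' : Θ h' = h') (hh' : h' ≠ 0)
    (haniso : ¬ ∃ x : M, x ≠ 0 ∧ h' * Θ x * x + ρ (h' * Θ x * x) = 0)
    (f' : ℕ → ℕ → AddSubgroup M → ℕ) (hfinLS' : ∀ j a, (levelSet ρ Θ α (jE ϖ) h' j a).Finite)
    (hf' : ∀ (b j : ℕ) (Λ : AddSubgroup M) (x₀ : M) (r : E), 1 ≤ b → x₀ ≠ 0 → (∀ x, x ∈ Λ ↔ ∃ z, IsOrd ρ α (jE ϖ ^ j) z ∧ x = x₀ * z) →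
      IsOrd ρ α (jE ϖ ^ j) (dualGen ρ Θ α (jE ϖ ^ j) h' x₀) → ¬ IsOrd ρ α (jE ϖ ^ j) (dualGen ρ Θ α (jE ϖ ^ j) h' x₀ / jE ϖ) → Valued.v (dualGen ρ Θ α (jE ϖ ^ j) h' x₀) = Valued.v (jE ϖ) ^ b →
      (∀ b', (∀ x ∈ Λ, Valued.v (h' * Θ x * b' + ρ (h' * Θ x * b')) ≤ 1) → (lam - jE ((u : Matrix (Fin 1) (Fin 1) E) 0 0)) * b' ∈ Λ) → IsOrd ρ α (jE ϖ ^ j) lam →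
      jE r = glueUnit ρ Θ α (jE ϖ ^ j) h' (jE ϖ) (jE η) x₀ b →
      f' b j Λ = Nat.card {x : 𝒪[E] ⧸ 𝓂[E] ^ (2 * b) // ∃ u' : 𝒪[E], Ideal.Quotient.mk (𝓂[E] ^ (2 * b)) u' = x ∧ Valued.v ((u' : E) * σ u' - r) ≤ Valued.v (ϖ ^ (2 * b))})
    -- the K6 floor (‹CORE.v1›'s `_hNm _hu1N _hlam1` at the assembler's fence value `N₀`, and `4d ≤ N₀`)
    {N₀ : ℕ} (h4d : 4 * d ≤ N₀) (hN₀m : N₀ ≤ m)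
    (hu1N : Valued.v (((u : Matrix (Fin 1) (Fin 1) E) 0 0) - 1) ≤ Valued.v (ϖ ^ N₀)) (hlam1 : Valued.v (lam - 1) ≤ Valued.v (jE ϖ ^ N₀))
    -- the live row (both parities, ★ A5's letter) at the gap-zero window `jl = m` (the top cell IS the diagonal cell `(b, b)`)
    (b : ℕ) (hbm : 2 * b + d % 2 = m) (hjlm : jl = m) :
    (((∑ᶠ Λ ∈ levelSetDep ρ Θ α (jE ϖ) h b b (lam - jE ((u : Matrix (Fin 1) (Fin 1) E) 0 0)) ∩
          {Λ | ∃ B : Submodule 𝒪[E] (Fin 2 → E), B.toAddSubgroup.map φ = Λ ∧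
            ∃ L₃ : Submodule 𝒪[E] (Fin 3 → E), IsSelfDualLattice σ ϖ (!![((StdForm.antidiagonal 2).over E) 0 0, 0, ((StdForm.antidiagonal 2).over E) 0 1; 0, (1 : E), 0; ((StdForm.antidiagonal 2).over E) 1 0, 0, ((StdForm.antidiagonal 2).over E) 1 1] : Matrix (Fin 3) (Fin 3) E) L₃ ∧
              L₃ ⊓ LinearMap.ker ((LinearMap.proj (1 : Fin 3) : (Fin 3 → E) →ₗ[E] E).restrictScalars 𝒪[E]) =
                B.map ((Matrix.toLin' (!![1, 0; 0, 0; 0, 1] : Matrix (Fin 3) (Fin 2) E)).restrictScalars 𝒪[E]) ∧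
              (∀ c : E, (Pi.single 1 c : Fin 3 → E) ∈ L₃ ↔ Valued.v c ≤ Valued.v ϖ ^ b) ∧
              (LatticeNearTransvShell ϖ (d % 2) (mstarOfRecord d) ((((endoGL (γ₂, u) : GL (Fin 3) E) : Matrix (Fin 3) (Fin 3) E) - 1)) L₃ ∧
                {z : E | ∃ y ∈ L₃, Valued.v ((ϖ ^ (mstarOfRecord d))⁻¹ * (z - pairing σ (!![((StdForm.antidiagonal 2).over E) 0 0, 0, ((StdForm.antidiagonal 2).over E) 0 1; 0, (1 : E), 0; ((StdForm.antidiagonal 2).over E) 1 0, 0, ((StdForm.antidiagonal 2).over E) 1 1] : Matrix (Fin 3) (Fin 3) E) y (((((endoGL (γ₂, u) : GL (Fin 3) E) : Matrix (Fin 3) (Fin 3) E) - 1)) *ᵥ y))) ≤ 1} =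
                  valueSetMod σ ϖ (mstarOfRecord d) (xPlus σ ϖ d))}, f b b Λ : ℕ) : ℤ) -
        ((∑ᶠ Λ ∈ levelSetDep ρ Θ α (jE ϖ) h b b (lam - jE ((u : Matrix (Fin 1) (Fin 1) E) 0 0)) ∩
          {Λ | ∃ B : Submodule 𝒪[E] (Fin 2 → E), B.toAddSubgroup.map φ = Λ ∧
            ∃ L₃ : Submodule 𝒪[E] (Fin 3 → E), IsSelfDualLattice σ ϖ (!![((StdForm.antidiagonal 2).over E) 0 0, 0, ((StdForm.antidiagonal 2).over E) 0 1; 0, (1 : E), 0; ((StdForm.antidiagonal 2).over E) 1 0, 0, ((StdForm.antidiagonal 2).over E) 1 1] : Matrix (Fin 3) (Fin 3) E) L₃ ∧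
              L₃ ⊓ LinearMap.ker ((LinearMap.proj (1 : Fin 3) : (Fin 3 → E) →ₗ[E] E).restrictScalars 𝒪[E]) =
                B.map ((Matrix.toLin' (!![1, 0; 0, 0; 0, 1] : Matrix (Fin 3) (Fin 2) E)).restrictScalars 𝒪[E]) ∧
              (∀ c : E, (Pi.single 1 c : Fin 3 → E) ∈ L₃ ↔ Valued.v c ≤ Valued.v ϖ ^ b) ∧
              (LatticeNearTransvShell ϖ (d % 2) (mcOfRecord d) ((((endoGL (γ₂, u) : GL (Fin 3) E) : Matrix (Fin 3) (Fin 3) E) - 1)) L₃ ∧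
                ¬ {z : E | ∃ y ∈ L₃, Valued.v ((ϖ ^ (mstarOfRecord d))⁻¹ * (z - pairing σ (!![((StdForm.antidiagonal 2).over E) 0 0, 0, ((StdForm.antidiagonal 2).over E) 0 1; 0, (1 : E), 0; ((StdForm.antidiagonal 2).over E) 1 0, 0, ((StdForm.antidiagonal 2).over E) 1 1] : Matrix (Fin 3) (Fin 3) E) y (((((endoGL (γ₂, u) : GL (Fin 3) E) : Matrix (Fin 3) (Fin 3) E) - 1)) *ᵥ y))) ≤ 1} =
                  valueSetMod σ ϖ (mstarOfRecord d) (xPlus σ ϖ d))}, f b b Λ : ℕ) : ℤ)) =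
      if 0 < d then
        (((∑ᶠ Λ ∈ levelSetDep ρ Θ α (jE ϖ) h' b b (lam - jE ((u : Matrix (Fin 1) (Fin 1) E) 0 0)) ∩
          {Λ | ∃ B : Submodule 𝒪[E] (Fin 2 → E), B.toAddSubgroup.map φ' = Λ ∧
            ∃ L₃ : Submodule 𝒪[E] (Fin 3 → E), IsSelfDualLattice σ ϖ (!![(Matrix.diagonal dg) 0 0, 0, (Matrix.diagonal dg) 0 1; 0, η, 0; (Matrix.diagonal dg) 1 0, 0, (Matrix.diagonal dg) 1 1] : Matrix (Fin 3) (Fin 3) E) L₃ ∧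
              L₃ ⊓ LinearMap.ker ((LinearMap.proj (1 : Fin 3) : (Fin 3 → E) →ₗ[E] E).restrictScalars 𝒪[E]) =
                B.map ((Matrix.toLin' (!![1, 0; 0, 0; 0, 1] : Matrix (Fin 3) (Fin 2) E)).restrictScalars 𝒪[E]) ∧
              (∀ c : E, (Pi.single 1 c : Fin 3 → E) ∈ L₃ ↔ Valued.v c ≤ Valued.v ϖ ^ b) ∧
              (LatticeNearTransvShell ϖ (d % 2) (mstarOfRecord d) ((((endoGL (γA, u) : GL (Fin 3) E) : Matrix (Fin 3) (Fin 3) E) - 1)) L₃ ∧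
                {z : E | ∃ y ∈ L₃, Valued.v ((ϖ ^ (mstarOfRecord d))⁻¹ * (z - pairing σ (!![(Matrix.diagonal dg) 0 0, 0, (Matrix.diagonal dg) 0 1; 0, η, 0; (Matrix.diagonal dg) 1 0, 0, (Matrix.diagonal dg) 1 1] : Matrix (Fin 3) (Fin 3) E) y (((((endoGL (γA, u) : GL (Fin 3) E) : Matrix (Fin 3) (Fin 3) E) - 1)) *ᵥ y))) ≤ 1} =
                  valueSetMod σ ϖ (mstarOfRecord d) (xPlus σ ϖ d))}, f' b b Λ : ℕ) : ℤ) -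
        ((∑ᶠ Λ ∈ levelSetDep ρ Θ α (jE ϖ) h' b b (lam - jE ((u : Matrix (Fin 1) (Fin 1) E) 0 0)) ∩
          {Λ | ∃ B : Submodule 𝒪[E] (Fin 2 → E), B.toAddSubgroup.map φ' = Λ ∧
            ∃ L₃ : Submodule 𝒪[E] (Fin 3 → E), IsSelfDualLattice σ ϖ (!![(Matrix.diagonal dg) 0 0, 0, (Matrix.diagonal dg) 0 1; 0, η, 0; (Matrix.diagonal dg) 1 0, 0, (Matrix.diagonal dg) 1 1] : Matrix (Fin 3) (Fin 3) E) L₃ ∧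
              L₃ ⊓ LinearMap.ker ((LinearMap.proj (1 : Fin 3) : (Fin 3 → E) →ₗ[E] E).restrictScalars 𝒪[E]) =
                B.map ((Matrix.toLin' (!![1, 0; 0, 0; 0, 1] : Matrix (Fin 3) (Fin 2) E)).restrictScalars 𝒪[E]) ∧
              (∀ c : E, (Pi.single 1 c : Fin 3 → E) ∈ L₃ ↔ Valued.v c ≤ Valued.v ϖ ^ b) ∧
              (LatticeNearTransvShell ϖ (d % 2) (mcOfRecord d) ((((endoGL (γA, u) : GL (Fin 3) E) : Matrix (Fin 3) (Fin 3) E) - 1)) L₃ ∧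
                ¬ {z : E | ∃ y ∈ L₃, Valued.v ((ϖ ^ (mstarOfRecord d))⁻¹ * (z - pairing σ (!![(Matrix.diagonal dg) 0 0, 0, (Matrix.diagonal dg) 0 1; 0, η, 0; (Matrix.diagonal dg) 1 0, 0, (Matrix.diagonal dg) 1 1] : Matrix (Fin 3) (Fin 3) E) y (((((endoGL (γA, u) : GL (Fin 3) E) : Matrix (Fin 3) (Fin 3) E) - 1)) *ᵥ y))) ≤ 1} =
                  valueSetMod σ ϖ (mstarOfRecord d) (xPlus σ ϖ d))}, f' b b Λ : ℕ) : ℤ))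
      else 0 := by
  obtain ⟨hσσ', hvσ, hϖ, hfix, hdiff, hd1, -⟩ := id hD
  -- (δ) the row's gap-zero chart and label letters (★ p865093, both parities)
  obtain ⟨κ₀, ξ₀, μa, μb, R₀, γ₀, α₁, γ₁, hκ₀, hΘκ₀, hκ₀1, hκ₀v, hξ, hΘξ, hξ0, hξ1, hξv, hμab, hR₀, hγ₀, hâle, hbv, hα₁σ, hα₁1, hγ₁σ, hγ₁v, hγ₁1, hαγ,
    hγα, haff0⟩ := exists_rowDiagChart_letters_gapZero hD jE hjiso hjfix hΘj hρρ hvρ hΘρ hα hα1 hint hU hDM hq hσres hτ lam ((u : Matrix (Fin 1) (Fin 1) E) 0 0)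
      hm hjl hbm hjlm
  -- the top digit system `Rt` modulo `|ϖ|^b` (★ `exists_repr_fixedBall_card` at level `t := 0`, the card dropped); `2d − 1 ≤ b` from the K6 floor
  obtain ⟨Rt, hRt1, hRt2, hRt3, -⟩ := exists_repr_fixedBall_card hσσ' hvσ hfix hϖ hdiff b 0
  simp only [Nat.mul_zero, pow_zero, Nat.add_zero] at hRt1 hRt2 hRt3
  -- (γ-2) the two gap-zero CELL LAWS at ‹CORE›'s frames (★ LH4-p15 (g3), over ★ (α) F3 LH4-p12 (g10))
  have hlawH := diagCell_law_hyper_gapZero σ ϖ d tE hD jE ρ Θ α lam hρρ hvρ hjv hjfix hΘj hΘΘ hΘρ hvΘ hα hα1 hint hΘlam hvlam hU hτ hσres hDM hjiso hq hjpow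
    hϖmax γ₂ u m jl hm hjl hum hΓ φ h hφs hφi hφo hφγ hform hΘh hh f hf hfinLS h4d hN₀m hu1N hlam1 b hbm h2 hjlm hκ₀ hΘκ₀ hκ₀1 hξ hΘξ hξv hμab hR₀ hγ₀
    hα₁σ hγ₁σ hγ₁1 hαγ haff0 Rt (n := b) (by omega) le_rfl hRt1 hRt2 hRt3
  have hlawA := diagCell_law_aniso_gapZero σ ϖ d tE hD jE ρ Θ α lam hρρ hvρ hjv hjfix hΘj hΘΘ hΘρ hvΘ hα hα1 hint hΘlam hvlam hU hτ hσres hDM hjiso hq hjpow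
    hϖmax u m jl hm hjl hum P₁ dg η γA hA hΓ' hdg1 hdgσ hησ hη1 φ' h' hφ's hφ'i hφ'o hφ'γ hform' hΘh' hh' f' hf' hfinLS' h4d hN₀m hu1N hlam1 b hbm h2 hjlm hκ₀
    hΘκ₀ hκ₀1 hξ hΘξ hξv hμab hR₀ hγ₀ hα₁σ hγ₁σ hγ₁1 hαγ haff0 Rt (n := b) (by omega) le_rfl hRt1 hRt2 hRt3
  -- A5-SIZES: ONE density for both literals at the gap-zero cell (★ p865144 at `N := 0`; `|ξ₀| = exp (2·0)` from `|ξ₀| = 1`), the even∕odd size table picked by `d % 2`; then ★ (γ)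
  have hξN : Valued.v ξ₀ = exp (2 * ((0 : ℕ) : ℤ)) := by rw [hξ1, Nat.cast_zero, mul_zero, exp_zero]
  rcases Nat.mod_two_eq_zero_or_one d with hd2 | hd2
  · obtain ⟨φd, hdensH, hdensA⟩ := exists_topCell_density_of_row σ ϖ d tE hD hσσ h2 jE ρ Θ α lam hρρ hvρ hjv hjfix hΘj hΘΘ hΘρ hvΘ hα hα1 hint hvlam hU hτ
      hσres hDM hjiso hq hjpow hϖmax u m jl hm hjl γ₂ φ h hφs hφi hφo hφγ hform hΘh hh hhyper f hfinLS hf P₁ dg η γA hA hdgσ hησ hη1 hηN φ' h' hφ's hφ'i hφ'o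
      hφ'γ hform' hΘh' hh' haniso f' hfinLS' hf' b (by omega) (by omega) (N := 0) (by omega) hκ₀ hΘκ₀ hκ₀v hξ hΘξ hξN Rt (n := b) (by omega) le_rfl hRt1 hRt2 hRt3
    simp only [Nat.mul_zero, Nat.add_zero] at hdensH hdensA
    exact diagCell_gapZero_identity_of_laws σ ϖ d tE hD h2 jE ρ Θ α lam hρρ hvρ hΘρ hjfix hΘj hjiso hU u γ₂ φ h hform hΘh hh f hfinLS P₁ dg η γA hA hησ hηN φ' h'
      hform' hΘh' hh' f' hfinLS' b hκ₀ hΘκ₀ hκ₀v hξ hΘξ hξ1 hα₁σ hα₁1 hγ₁σ hγ₁v hαγ hγα Rt (n := b) (by omega) hRt1 hRt2 hRt3 hlawH hlawA hdensH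
      (hdensA (by omega))
  · obtain ⟨φd, hdensH, hdensA⟩ := exists_topCell_density_of_row_odd σ ϖ d tE hD hσσ h2 jE ρ Θ α lam hρρ hvρ hjv hjfix hΘj hΘΘ hΘρ hvΘ hα hα1 hint hvlam hU hτ
      hσres hDM hjiso hq hjpow hϖmax u m jl hm hjl γ₂ φ h hφs hφi hφo hφγ hform hΘh hh hhyper f hfinLS hf P₁ dg η γA hA hdgσ hησ hη1 hηN φ' h' hφ's hφ'i hφ'o
      hφ'γ hform' hΘh' hh' haniso f' hfinLS' hf' b (by omega) (by omega) (N := 0) (by omega) hκ₀ hΘκ₀ hκ₀v hξ hΘξ hξN Rt (n := b) (by omega) le_rfl hRt1 hRt2 hRt3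
    simp only [Nat.mul_zero, Nat.add_zero] at hdensH hdensA
    exact diagCell_gapZero_identity_of_laws σ ϖ d tE hD h2 jE ρ Θ α lam hρρ hvρ hΘρ hjfix hΘj hjiso hU u γ₂ φ h hform hΘh hh f hfinLS P₁ dg η γA hA hησ hηN φ' h'
      hform' hΘh' hh' f' hfinLS' b hκ₀ hΘκ₀ hκ₀v hξ hΘξ hξ1 hα₁σ hα₁1 hγ₁σ hγ₁v hαγ hγα Rt (n := b) (by omega) hRt1 hRt2 hRt3 hlawH hlawA hdensH
      (hdensA (by omega))

end Summit.HodgeConjecture.HodgeConjecture.Cruxes.H413.F0P3cDyRamDiagCellGapZeroIdentityOfRow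

end
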